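import Summits.QuantumFields.YangMills.Theorems.BalabanUVNodesN15NeumannCubeAdjointTailRow
import Summits.QuantumFields.YangMills.Theorems.BalabanUVNodesN15TwoSpacingGluingCurvedCoverDefectRows
import HarnessLib

/-!
# THE ADJOINT TAIL AT THE COVER: the flat images cube's TRUE right-locality defect on the cover's partition, EXACTLY and on the coloured carrier (`⊗ 1_ι`), its row EXPONENTIALLY SMALL IN THE
# MARGIN — n15-c∕170 at FILE 70's window (doubled torus `M_ν = 2qw`, cubes `□_k` of side `qw`, partition `h_k`, radius-2 bump `χ̃_k`) lifted as FILE 118 lifts the direct tail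
# (dag-n15-c g19, n15-c∕171; N15 = NE2, s1 road (c) — the producer of FILES n15-c∕167–169's `hloc`∕`hEd` at the cover)

Cell `pub-ymgap`, seat `pub-ymgap-dag-n15-c` (R134 (a); HUMAN RULING D-0062), generation 19.  `bears_on: R4∕N15 · K3⁸ SpineGivenEndpointR13SepCoPHV (stmt-QuantumFields-27366)`.
Filed `--kind proof --supports stmt-QuantumFields-27366 --as helper` — COUNT-NEUTRAL.  Theorems only; 0 `def`, 0 `sorry`.  Imports BY NAME n15-c∕170 `…NeumannCubeAdjointTailRow`
(`bump_neumannCubeG_deltaOp_mulOp_eq`, `hasMaj_adjTail_neumannCubeG`, `hasMaj_idef_adjTail_neumannCubeG_of`) and FILE 122 `…TwoSpacingGluingCurvedCoverDefectRows` (through it FILE 121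
`hasMaj_idef_tensorId`, FILE 118 `lapOp_liftEquiv_eq` ∕ `hasMaj_tensorId` ∕ the tensorId dictionary, FILE 70∕117 `mem_intBonds_of_hcube_ne_zero`, `chiCube_coverCorner_eq_one`,
`val_blockOf_sub_of_hcube_ne_zero`, `margin_le_tdistT`, FILE 67 `abs_coverH_fine_sub_le`, dag-n15-w4 `bcube_cover_eq_one_of_coverH_ne_zero_two`, `blockOf_mem_cubeBlocks_of_bcube_cover_ne_zero`,
`val_sub_up_of_abs_cenRep_lt`, `abs_cenRep_lt_of_bcube_ne_zero`, `abs_bcube_cover_le_one`, `abs_bcube_cover_fine_sub_le`).  Nothing in the tree is modified.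

WHY.  FILES n15-c∕167–169 display, per cube, the TRUE right-locality defect `Ẽ_k` of the dressed smooth-cut cube; FILE 148 `projO_dressedV_comp_lap_mulOp` reduces it to the FLAT cube's defect
`F^flat_k`: `M_χ̃N_k(Δ₀ ⊗ 1 + N_L ⊗ 1)M_{h_k} = M_{h_k} + F^flat_k`.  n15-c∕170 computed `F^flat` EXACTLY for the images cube on the scalar carrier; THIS FILE puts it at the cover's window and
lifts it to the coloured carrier: the identity (for the generated cover files' `hflat`), the row (for `ε_E`), with the support facts of the cover (partition on interior bonds with its one-step
neighbours in the cube, bump `= 1` on the partition and inside the cube AND ON INTERIOR BONDS — §1's `mem_intBonds_of_bcube_cover_ne_zero`, margin `m₀ + 1` from outside the cube to the window).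

WHAT.  §1 `mem_intBonds_of_bcube_cover_ne_zero`; §2 ★★ `adjTail_cover_eq` (scalar) and ★★ `adjTail_cover_lift_eq` (coloured: `(M_{χ̃∘fst}∘(G(□_k) ⊗ 1))∘(Σ∇̂*∇̂ + 0 + N_L ⊗ 1)∘M_{h∘fst} =
M_{h∘fst} + (−(M_χ̃(χ_□Sym(G M_{1−χ_□}N_LM_h)χ_□)) ⊗ 1)`); §3 ★★ `hasMaj_adjTail_cover_lift` (its row `≤ 1_□1_□·2^{d+1}(C·c_Ne^{−(δ_N−ρ₁)(m₀+1)}c_r)e^{ρ}·e^{−ρd}`, torus letters displayed as in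
FILE 118 `hasMaj_tail_cover_lift`); §4 ★★★ `hasMaj_idef_adjTail_cover_lift` (its two-grid η-defect on the coloured carrier: n15-c∕170 ★★★ at the window with the cover's partition∕bump fits
`π(d+1)∕(L^k w)` and gap `m₀ + 1`, lifted by FILE 121 `hasMaj_idef_tensorId`; pattern of FILE 122 `hasMaj_idef_tail_cover_lift`).

HONEST FRAMING ∕ LIMITS.  Bookkeeping over LANDED theorems on dag-n15-a's model carriers; nothing of [B5]∕[B6]∕[B9] asserted ((2.36)–(2.38) p.229, (2.91)–(2.93) p.239, (2.133) p.247,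
(2.156) p.250 = SHAPES ∕ MECHANISM).  NE2 for non-abelian `G(U)` NOT proved (C-N15-1); N15 booked «discharged AS CONSUMED at the U-blind v7 pin» (№253) — road (c)'s bookkeeping, NO count;
one finite 𝕋⁴ at fixed ε — NOT infinite volume, NOT OS, NOT a mass gap, NOT Clay.  Restate-immune (no Theses import).
-/

noncomputable section

open scoped BigOperators
open Finset

namespace Summit.QuantumFields.YangMills.BalabanUVNodes.N15.Gluing

open Real
open Literature.MathematicalPhysics.QuantumFieldTheory.Balaban1983to89
open Literature.MathematicalPhysics.QuantumFieldTheory.Balaban1983to89.B5Prop11Plancherel (Tor fine unitVec)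
open Literature.MathematicalPhysics.QuantumFieldTheory.Balaban1983to89.B5Block118 (up)
open Literature.MathematicalPhysics.QuantumFieldTheory.Balaban1983to89.B11SectG (BlockNorm HasMaj RowSum)
open Literature.MathematicalPhysics.QuantumFieldTheory.Balaban1983to89.T4EtaRateDefect (idef)
open Literature.MathematicalPhysics.QuantumFieldTheory.Balaban1983to89.T4EtaRateCoeffDefect (pull)
open Literature.MathematicalPhysics.QuantumFieldTheory.Balaban1983to89.B6RandomWalk (Triangle254)
open Literature.MathematicalPhysics.QuantumFieldTheory.Balaban1983to89.B6Prop26Gluing (mulOp mulOp_apply ind ind_nonneg ind_le_one)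
open Literature.MathematicalPhysics.QuantumFieldTheory.Balaban1983to89.B6UnitTorusCarrier (unitTorusGeo)
open Literature.MathematicalPhysics.QuantumFieldTheory.King1986.Torus (blockOf tdistT tdistT_nonneg)
open Summit.QuantumFields.YangMills.BalabanUVNodes.N15.BackgroundLayer (tensorId_add tensorId_comp_tensorId tensorId_sub tensorId_neg)
open Summit.QuantumFields.YangMills.BalabanUVNodes.N15.VectorPiece (bshiftEquiv bshiftEquiv_apply bshiftEquiv_symm_apply kingPrV tensorId tensorId_apply hasMaj_tensorId)
open Summit.QuantumFields.YangMills.BalabanUVNodes.N15.MatrixSpecies (liftBlk liftMap liftEquiv liftEquiv_apply liftEquiv_symm_apply)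
open Summit.QuantumFields.YangMills.BalabanUVNodes.N15.TwoGrid (symbOp sD landauRe qvRe qvAdjRe gOp neumannCubeG symOp chiCube cubeBlocks intBonds mem_intBonds tensorId_mulOp mulOp_fst_comp_tensorId
  tensorId_comp_mulOp_fst bump_neumannCubeG_deltaOp_mulOp_eq hasMaj_adjTail_neumannCubeG hasMaj_idef_adjTail_neumannCubeG_of)

variable {d : ℕ}

section Cover

variable {M : Fin (d + 1) → ℕ} [∀ μ, NeZero (M μ)] {L kk n w q m₀ : ℕ} [NeZero n] (ι : Type) [Fintype ι]

/-! ## §1 The bump lives on interior bonds -/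

omit [Fintype ι] in
/-- ★ **`supp χ̃_k ⊂` THE INTERIOR BONDS OF `□_k`** (the radius-2 bump sits `≥ m₀ − 2w ≥ 1` blocks above the corner and `≥ qw − m₀ − 4w − 1 ≥ 1` blocks below the upper faces, so it never meets the
seam layer): window `2w ≤ m₀`, `m₀ + 4w + 1 ≤ qw`. [cite: Balaban1984PropagatorsII, (2.37) p.229 (the cube's interior: shape); Balaban1985BackgroundPropagators, (3.62)–(3.65) pp.402–403] -/
theorem mem_intBonds_of_bcube_cover_ne_zero (hM : ∀ ν, M ν = 2 * q * w) (hw : 0 < w) (hlo : 2 * w ≤ m₀) (hhi : m₀ + 4 * w + 1 ≤ q * w) {k : Fin (d + 1) → ZMod (2 * q)}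
    {b : Tor (fine n M) × Fin (d + 1)} (hb : bcube (2 * q) (coverXi M n w) 2 k b ≠ 0) : b ∈ intBonds M n (coverCorner M w q m₀ k) (q * w) := by
  have hn : 1 ≤ n := Nat.one_le_iff_ne_zero.mpr (NeZero.ne n)
  have hq2 : q * w ≤ 2 * q * w := by nlinarith
  have hlo' : ((3 : ℝ) - 1) * w ≤ m₀ := by have h := (Nat.cast_le (α := ℝ)).mpr hlo; push_cast at h; linarith
  have hhi' : (m₀ : ℝ) + w + 3 * w ≤ 2 * q * w := by
    have h1 := (Nat.cast_le (α := ℝ)).mpr hhi; have h2 := (Nat.cast_le (α := ℝ)).mpr hq2; push_cast at h1 h2; linarith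
  have hwin : ∀ ν, (((b.1 - up n M (coverCorner M w q m₀ k)) ν).val : ℝ) < (n : ℝ) * ((m₀ : ℝ) + w) + 3 * ((n : ℝ) * w) := fun ν =>
    (val_sub_up_of_abs_cenRep_lt hM hw (ρ := 3) hlo' hhi' ((abs_cenRep_lt_of_bcube_ne_zero (2 * q) (coverXi M n w) 2 hb ν).trans_eq (by norm_num))).2
  have hup : ∀ ν, ((b.1 - up n M (coverCorner M w q m₀ k)) ν).val + 1 < q * w * n := fun ν => by
    have h1 := hwin ν
    have h2 : (n : ℝ) * ((m₀ : ℝ) + w) + 3 * ((n : ℝ) * w) + 1 ≤ (q * w * n : ℕ) := by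
      push_cast
      have : ((m₀ : ℝ) + 4 * w + 1) * n ≤ (q : ℝ) * w * n := by
        have hh : ((m₀ : ℝ) + 4 * w + 1) ≤ (q : ℝ) * w := by exact_mod_cast hhi
        exact mul_le_mul_of_nonneg_right hh (by positivity)
      have hn1 : (1 : ℝ) ≤ n := by exact_mod_cast hn
      nlinarith
    exact_mod_cast (show (((b.1 - up n M (coverCorner M w q m₀ k)) ν).val : ℝ) + 1 < (q * w * n : ℕ) by linarith)
  rw [mem_intBonds]
  exact ⟨fun ν => by have := hup ν; rw [Pi.sub_apply] at this; omega, fun h => by have := hup b.2; rw [Pi.sub_apply] at this; omega⟩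

/-! ## §2 The flat images cube's right-locality defect on the cover's partition, scalar and coloured -/

/-- ★★ **THE ADJOINT TAIL AT THE COVER, EXACTLY** (scalar carrier): on the doubled torus `M_ν = 2qw = 2S`, for the cube `□_k` (`2w ≤ m₀`, `m₀ + 4w + 1 ≤ S = qw`), the partition `h_k` and the
radius-2 bump `χ̃_k`:  `M_χ̃∘G(□_k)∘(Σ∇*∇ + 0 + (aQ*Q − ∂Π∂*))∘M_h = M_h − M_χ̃∘(χ_□∘Sym∘(G∘(M_{1−χ_□}∘(aQ*Q − ∂Π∂*)∘M_h))∘χ_□)` — n15-c∕170 ★★ with every support fact of the window discharged.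
[cite: Balaban1984PropagatorsII, (2.36)–(2.38) p.229, (2.91)–(2.93) p.239 (mechanism)] -/
theorem adjTail_cover_eq (hM : ∀ ν, M ν = 2 * q * w) (hw : 0 < w) (hlo : 2 * w ≤ m₀) (hhi : m₀ + 4 * w + 1 ≤ q * w) {a : ℝ} (ha : 0 < a) (k : Fin (d + 1) → ZMod (2 * q)) :
    mulOp (bcube (2 * q) (coverXi M n w) 2 k) ∘ₗ neumannCubeG M n (coverCorner M w q m₀ k) (q * w) a ∘ₗ
        (lapOp (n : ℝ) (bshiftEquiv M n) 0 + (a • (qvAdjRe M n ∘ₗ qvRe M n) + (-landauRe M n))) ∘ₗ mulOp (hcube (2 * q) (coverXi M n w) k) =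
      mulOp (hcube (2 * q) (coverXi M n w) k) - mulOp (bcube (2 * q) (coverXi M n w) 2 k) ∘ₗ (mulOp (chiCube M n (coverCorner M w q m₀ k) (q * w)) ∘ₗ symOp M n (coverCorner M w q m₀ k) ∘ₗ
        (gOp M n a ∘ₗ (mulOp (1 - chiCube M n (coverCorner M w q m₀ k) (q * w)) ∘ₗ (a • (qvAdjRe M n ∘ₗ qvRe M n) + (-landauRe M n)) ∘ₗ mulOp (hcube (2 * q) (coverXi M n w) k))) ∘ₗ
          mulOp (chiCube M n (coverCorner M w q m₀ k) (q * w))) := by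
  have hM' : ∀ ν, M ν = 2 * (q * w) := fun ν => by rw [hM ν, mul_assoc]
  have hfit : m₀ + 2 * w + 1 ≤ q * w := by omega
  have hS : q * w ≤ 2 * q * w := by rw [mul_assoc]; omega
  have hhi' : (m₀ : ℝ) + w + (2 + 1) * w + 1 ≤ (q * w : ℕ) := by
    have : ((m₀ + 4 * w + 1 : ℕ) : ℝ) ≤ ((q * w : ℕ) : ℝ) := by exact_mod_cast hhi
    push_cast at this ⊢; linarith
  refine bump_neumannCubeG_deltaOp_mulOp_eq hM' ha (fun b hb => mem_intBonds_of_bcube_cover_ne_zero hM hw hlo hhi hb) (fun b hb => mem_intBonds_of_hcube_ne_zero hM hw hfit hb)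
    (fun b hb => bcube_cover_eq_one_of_coverH_ne_zero_two 2 hM hw le_rfl 0 (Or.inl rfl) hb) (fun b hb => ?_)
    (fun b hb => chiCube_coverCorner_eq_one hM hw hfit 0 k b ⟨b, Or.inl rfl, abs_cenRep_lt_one_of_hcube_ne_zero (2 * q) (coverXi M n w) hb⟩)
    (fun μ b hb => chiCube_coverCorner_eq_one hM hw hfit μ k _ ⟨b, Or.inr (Or.inl (by simp)), abs_cenRep_lt_one_of_hcube_ne_zero (2 * q) (coverXi M n w) hb⟩)
    (fun μ b hb => chiCube_coverCorner_eq_one hM hw hfit μ k _ ⟨b, Or.inr (Or.inr (by simp)), abs_cenRep_lt_one_of_hcube_ne_zero (2 * q) (coverXi M n w) hb⟩)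
  have hmem := blockOf_mem_cubeBlocks_of_bcube_cover_ne_zero 2 hM hw (by exact_mod_cast hlo) hhi' hS hb
  unfold chiCube
  rw [if_pos hmem]

omit [Fintype ι] in
/-- ★★ **… ON THE COLOURED CARRIER** (the generated cover files' `hflat` for FILE 148 `projO_dressedV_comp_lap_mulOp`):
`(M_{χ̃∘fst}∘(G(□_k) ⊗ 1))∘(Σ∇̂*∇̂ + 0 + N_L ⊗ 1)∘M_{h∘fst} = M_{h∘fst} + (−(M_χ̃(χ_□Sym(G∘M_{1−χ_□}N_LM_h)χ_□)) ⊗ 1)` (FILE 118 `lapOp_liftEquiv_eq` and the `rfl`-dictionary).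
[cite: Balaban1984PropagatorsII, (2.91)–(2.93) p.239, (2.156) p.250 (the `U ≡ 1` operator acts diagonally in the colour: shape)] -/
theorem adjTail_cover_lift_eq (hM : ∀ ν, M ν = 2 * q * w) (hw : 0 < w) (hlo : 2 * w ≤ m₀) (hhi : m₀ + 4 * w + 1 ≤ q * w) {a : ℝ} (ha : 0 < a) {c : ℝ} (hc : c = (n : ℝ))
    (k : Fin (d + 1) → ZMod (2 * q)) :
    (mulOp (fun p : (Tor (fine n M) × Fin (d + 1)) × ι => bcube (2 * q) (coverXi M n w) 2 k p.1) ∘ₗ tensorId ι (neumannCubeG M n (coverCorner M w q m₀ k) (q * w) a)) ∘ₗ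
        (lapOp c (fun μ => liftEquiv (bshiftEquiv M n μ) ι) 0 + tensorId ι (a • (qvAdjRe M n ∘ₗ qvRe M n) + (-landauRe M n))) ∘ₗ
        mulOp (fun p : (Tor (fine n M) × Fin (d + 1)) × ι => hcube (2 * q) (coverXi M n w) k p.1) =
      mulOp (fun p : (Tor (fine n M) × Fin (d + 1)) × ι => hcube (2 * q) (coverXi M n w) k p.1) +
        -tensorId ι (mulOp (bcube (2 * q) (coverXi M n w) 2 k) ∘ₗ (mulOp (chiCube M n (coverCorner M w q m₀ k) (q * w)) ∘ₗ symOp M n (coverCorner M w q m₀ k) ∘ₗ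
          (gOp M n a ∘ₗ (mulOp (1 - chiCube M n (coverCorner M w q m₀ k) (q * w)) ∘ₗ (a • (qvAdjRe M n ∘ₗ qvRe M n) + (-landauRe M n)) ∘ₗ mulOp (hcube (2 * q) (coverXi M n w) k))) ∘ₗ
            mulOp (chiCube M n (coverCorner M w q m₀ k) (q * w)))) := by
  subst hc
  have h := adjTail_cover_eq (n := n) hM hw hlo hhi ha k
  rw [← LinearMap.comp_assoc _ (neumannCubeG M n (coverCorner M w q m₀ k) (q * w) a) (mulOp (bcube (2 * q) (coverXi M n w) 2 k))] at h
  rw [lapOp_liftEquiv_eq, ← tensorId_add, mulOp_fst_comp_tensorId, tensorId_comp_mulOp_fst, tensorId_comp_tensorId, h, tensorId_sub, tensorId_mulOp, sub_eq_add_neg]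

/-! ## §3 Its row on the coloured carrier: exponentially small in the margin -/

/-- ★★ **THE ADJOINT TAIL's ROW AT THE COVER**: on the doubled torus `M_ν = 2qw = 2S` (`2w ≤ m₀`, `2m₀ + 2w + 1 ≤ S`), from the torus letters `G ≤ Ce^{−δ₀d}`, `∂Π∂* ≤ C₁e^{−δ₁d}`, a row sum `c_r`
at rate `σ`, `0 ≤ ρ ≤ ρ₁ ≤ δ_N ≤ δ₁`, `ρ + σ ≤ δ₀`:  `(M_χ̃(χ_□Sym(G M_{1−χ_□}N_LM_h)χ_□)) ⊗ 1 ≤ 1_□(y)1_□(y′)·2^{d+1}(1·C·c_Ne^{−(δ_N−ρ₁)(m₀+1)}·c_r)e^{ρ}·e^{−ρ|y−y′|_T}`, `c_N = |a|e^{2δ_N} + C₁`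
— EXPONENTIALLY SMALL IN THE MARGIN `m₀` (n15-c∕170 ★★ at the window: the partition's blocks are the window `[m₀, m₀+2w]^{d+1}`, at torus distance `≥ m₀ + 1` from every block outside the cube).
[cite: Balaban1984PropagatorsII, (2.36)–(2.37) p.229, Lemma 2.1 (2.61) p.234, (2.92)–(2.93) p.239, (2.133) p.247, (2.156) p.250; Balaban1984PropagatorsI, (1.69) p.29, Prop. 1.2 (1.110) p.35, (1.120)–(1.123) p.37, (1.126) p.38] -/
theorem hasMaj_adjTail_cover_lift (hM : ∀ ν, M ν = 2 * q * w) (hw : 0 < w) (hfit : 2 * m₀ + 2 * w + 1 ≤ q * w) {a C δ₀ C₁ δ₁ δN ρ₁ ρ σ cr : ℝ}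
    (htri : Triangle254 (unitTorusGeo L kk M)) (hrow : RowSum (unitTorusGeo L kk M) σ cr) (hC : 0 ≤ C) (hC₁ : 0 ≤ C₁) (hδN : 0 ≤ δN) (hδN₁ : δN ≤ δ₁) (hρ₁ : ρ₁ ≤ δN) (hρ : 0 ≤ ρ)
    (hρρ₁ : ρ ≤ ρ₁) (hρσ : ρ + σ ≤ δ₀)
    (hG : HasMaj (BlockNorm.ofBlocks (unitTorusGeo L kk M) (fun b : Tor (fine n M) × Fin (d + 1) => blockOf n M b.1))
      (BlockNorm.ofBlocks (unitTorusGeo L kk M) (fun b : Tor (fine n M) × Fin (d + 1) => blockOf n M b.1)) (gOp M n a) (fun y y' => C * Real.exp (-(δ₀ * tdistT M y y'))))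
    (hNL : HasMaj (BlockNorm.ofBlocks (unitTorusGeo L kk M) (fun b : Tor (fine n M) × Fin (d + 1) => blockOf n M b.1))
      (BlockNorm.ofBlocks (unitTorusGeo L kk M) (fun b : Tor (fine n M) × Fin (d + 1) => blockOf n M b.1)) (landauRe M n) (fun y y' => C₁ * Real.exp (-(δ₁ * tdistT M y y'))))
    (k : Fin (d + 1) → ZMod (2 * q)) :
    HasMaj (BlockNorm.ofBlocks (unitTorusGeo L kk M) (liftBlk (fun b : Tor (fine n M) × Fin (d + 1) => blockOf n M b.1) ι))
      (BlockNorm.ofBlocks (unitTorusGeo L kk M) (liftBlk (fun b : Tor (fine n M) × Fin (d + 1) => blockOf n M b.1) ι))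
      (tensorId ι (mulOp (bcube (2 * q) (coverXi M n w) 2 k) ∘ₗ (mulOp (chiCube M n (coverCorner M w q m₀ k) (q * w)) ∘ₗ symOp M n (coverCorner M w q m₀ k) ∘ₗ
        (gOp M n a ∘ₗ (mulOp (1 - chiCube M n (coverCorner M w q m₀ k) (q * w)) ∘ₗ (a • (qvAdjRe M n ∘ₗ qvRe M n) + (-landauRe M n)) ∘ₗ mulOp (hcube (2 * q) (coverXi M n w) k))) ∘ₗ
          mulOp (chiCube M n (coverCorner M w q m₀ k) (q * w)))))
      (fun y y' => ind ((cubeBlocks M (coverCorner M w q m₀ k) (q * w) : Finset (Tor M)) : Set (Tor M)) y * ind ((cubeBlocks M (coverCorner M w q m₀ k) (q * w) : Finset (Tor M)) : Set (Tor M)) y' *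
        (2 ^ (d + 1) * ((1 : ℝ) * C * ((|a| * (Real.exp δN * Real.exp δN) + C₁) * Real.exp (-((δN - ρ₁) * ((m₀ : ℝ) + 1)))) * cr * Real.exp ρ) * Real.exp (-(ρ * (unitTorusGeo L kk M).dist y y')))) := by
  have hM' : ∀ ν, M ν = 2 * (q * w) := fun ν => by rw [hM ν, mul_assoc]
  have hfit' : m₀ + 2 * w ≤ 2 * q * w := by nlinarith
  exact hasMaj_tensorId ι (fun y y' => mul_nonneg (mul_nonneg (ind_nonneg _ _) (ind_nonneg _ _)) (by have := hrow.nonneg y; positivity))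
    (hasMaj_adjTail_neumannCubeG (L := L) (k := kk) (c := coverCorner M w q m₀ k) (S := q * w) hM' htri hrow hC hC₁ hδN hδN₁ hρ₁ hρ hρρ₁ hρσ hG hNL
      (H := {y | ∀ ν, m₀ ≤ ((y - coverCorner M w q m₀ k) ν).val ∧ ((y - coverCorner M w q m₀ k) ν).val + 1 ≤ m₀ + 2 * w})
      (fun x => abs_bcube_cover_le_one 2 k x) (fun x => abs_hcube_le_one (2 * q) (coverXi M n w) k x)
      (fun x hx => by by_contra hne; exact hx fun ν => val_blockOf_sub_of_hcube_ne_zero hM hw hfit' hne ν)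
      (fun y y' hy hy' => margin_le_tdistT hM hfit hy hy'))

end Cover

section Defect

variable {M : Fin (d + 1) → ℕ} [∀ μ, NeZero (M μ)] {L kk r w q m₀ : ℕ} [NeZero L] (ι : Type) [Fintype ι]

/-! ## §4 Its two-spacing η-defect on the coloured carrier (coarse `L^k`, fine `L^r·L^k`, King's pairing lifted to the colour) -/

/-- ★★★ **THE ADJOINT TAIL's TWO-GRID DEFECT AT THE COVER** (the `r_E`-producer of FILES n15-c∕167–169 at the cover): on the doubled torus `M_ν = 2qw` (`2m₀ + 2w + 1 ≤ qw`), n15-c∕170 ★★★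
`hasMaj_idef_adjTail_neumannCubeG_of` at the window of the partition's blocks (gap `m₀ + 1`, FILE 70 `margin_le_tdistT`), with the cover's partition fit and bump fit `π(d+1)∕(L^k w)` (FILE 67
`abs_coverH_fine_sub_le`, dag-n15-w4 VI `abs_bcube_cover_fine_sub_le`), lifted to the coloured carrier by FILE 121 `hasMaj_idef_tensorId`; the torus letters `G`, `G′`, `𝔇(G′,G)`, `∇G`, `∂Π∂*`
(both spacings), `𝔇(N′_L,N_L)` displayed — every summand carries a two-grid letter, a fit, or `1∕L^k`, times `e^{−(δ_N−ρ₁)(m₀+1)}`.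
[cite: Balaban1985BackgroundPropagators, Thm 3.14 pp.426–427 (difference template); Balaban1984PropagatorsII, (2.36)–(2.37) p.229, (2.92)–(2.93) p.239, (2.133) p.247, (2.156) p.250] -/
theorem hasMaj_idef_adjTail_cover_lift (hM : ∀ ν, M ν = 2 * q * w) (hw : 0 < w) (hfit : 2 * m₀ + 2 * w + 1 ≤ q * w) {a : ℝ} {C C₀ CD δ₀ C₁ δ₁ δN rN ρ₁ ρ σ cr : ℝ}
    (htri : Triangle254 (unitTorusGeo L kk M)) (hrow : RowSum (unitTorusGeo L kk M) σ cr) (hC : 0 ≤ C) (hC₀ : 0 ≤ C₀) (hCD : 0 ≤ CD) (hC₁ : 0 ≤ C₁) (hδN : 0 ≤ δN)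
    (hδN₁ : δN ≤ δ₁) (hrN : 0 ≤ rN) (hρ₁ : ρ₁ ≤ δN) (hρ : 0 ≤ ρ) (hρρ₁ : ρ ≤ ρ₁) (hρσ : ρ + σ ≤ δ₀)
    (hG : HasMaj (BlockNorm.ofBlocks (unitTorusGeo L kk M) (fun b : Tor (fine (L ^ kk) M) × Fin (d + 1) => blockOf (L ^ kk) M b.1))
      (BlockNorm.ofBlocks (unitTorusGeo L kk M) (fun b : Tor (fine (L ^ kk) M) × Fin (d + 1) => blockOf (L ^ kk) M b.1)) (gOp M (L ^ kk) a)
      (fun y y' => C * Real.exp (-(δ₀ * tdistT M y y'))))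
    (hG' : HasMaj (BlockNorm.ofBlocks (unitTorusGeo L kk M) (fun b : Tor (fine (L ^ r * L ^ kk) M) × Fin (d + 1) => blockOf (L ^ r * L ^ kk) M b.1))
      (BlockNorm.ofBlocks (unitTorusGeo L kk M) (fun b : Tor (fine (L ^ r * L ^ kk) M) × Fin (d + 1) => blockOf (L ^ r * L ^ kk) M b.1)) (gOp M (L ^ r * L ^ kk) a)
      (fun y y' => C * Real.exp (-(δ₀ * tdistT M y y'))))
    (h0 : HasMaj (BlockNorm.ofBlocks (unitTorusGeo L kk M) (fun b : Tor (fine (L ^ kk) M) × Fin (d + 1) => blockOf (L ^ kk) M b.1))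
      (BlockNorm.ofBlocks (unitTorusGeo L kk M) (fun b' : Tor (fine (L ^ r * L ^ kk) M) × Fin (d + 1) => blockOf (L ^ r * L ^ kk) M b'.1))
      (idef (pull (kingPrV L kk r M)) (pull (kingPrV L kk r M)) (gOp M (L ^ r * L ^ kk) a) (gOp M (L ^ kk) a)) (fun y y' => C₀ * Real.exp (-(δ₀ * tdistT M y y'))))
    (h1 : ∀ ν, HasMaj (BlockNorm.ofBlocks (unitTorusGeo L kk M) (fun b : Tor (fine (L ^ kk) M) × Fin (d + 1) => blockOf (L ^ kk) M b.1))
      (BlockNorm.ofBlocks (unitTorusGeo L kk M) (fun b : Tor (fine (L ^ kk) M) × Fin (d + 1) => blockOf (L ^ kk) M b.1))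
      (symbOp M (L ^ kk) (sD M (L ^ kk) ν ((L ^ kk : ℕ) : ℝ)) ∘ₗ gOp M (L ^ kk) a) (fun y y' => CD * Real.exp (-(δ₀ * tdistT M y y'))))
    (hNL : HasMaj (BlockNorm.ofBlocks (unitTorusGeo L kk M) (fun b : Tor (fine (L ^ kk) M) × Fin (d + 1) => blockOf (L ^ kk) M b.1))
      (BlockNorm.ofBlocks (unitTorusGeo L kk M) (fun b : Tor (fine (L ^ kk) M) × Fin (d + 1) => blockOf (L ^ kk) M b.1)) (landauRe M (L ^ kk))
      (fun y y' => C₁ * Real.exp (-(δ₁ * tdistT M y y'))))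
    (hNL' : HasMaj (BlockNorm.ofBlocks (unitTorusGeo L kk M) (fun b : Tor (fine (L ^ r * L ^ kk) M) × Fin (d + 1) => blockOf (L ^ r * L ^ kk) M b.1))
      (BlockNorm.ofBlocks (unitTorusGeo L kk M) (fun b : Tor (fine (L ^ r * L ^ kk) M) × Fin (d + 1) => blockOf (L ^ r * L ^ kk) M b.1)) (landauRe M (L ^ r * L ^ kk))
      (fun y y' => C₁ * Real.exp (-(δ₁ * tdistT M y y'))))
    (hDN : HasMaj (BlockNorm.ofBlocks (unitTorusGeo L kk M) (fun b : Tor (fine (L ^ kk) M) × Fin (d + 1) => blockOf (L ^ kk) M b.1))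
      (BlockNorm.ofBlocks (unitTorusGeo L kk M) (fun b : Tor (fine (L ^ r * L ^ kk) M) × Fin (d + 1) => blockOf (L ^ r * L ^ kk) M b.1))
      (idef (pull (kingPrV L kk r M)) (pull (kingPrV L kk r M)) (a • (qvAdjRe M (L ^ r * L ^ kk) ∘ₗ qvRe M (L ^ r * L ^ kk)) + (-landauRe M (L ^ r * L ^ kk)))
        (a • (qvAdjRe M (L ^ kk) ∘ₗ qvRe M (L ^ kk)) + (-landauRe M (L ^ kk)))) (fun y y' => rN * Real.exp (-(δN * tdistT M y y'))))
    (k : Fin (d + 1) → ZMod (2 * q)) :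
    HasMaj (BlockNorm.ofBlocks (unitTorusGeo L kk M) (liftBlk (fun b : Tor (fine (L ^ kk) M) × Fin (d + 1) => blockOf (L ^ kk) M b.1) ι))
      (BlockNorm.ofBlocks (unitTorusGeo L kk M) (liftBlk (fun b' : Tor (fine (L ^ r * L ^ kk) M) × Fin (d + 1) => blockOf (L ^ r * L ^ kk) M b'.1) ι))
      (idef (pull (liftMap (kingPrV L kk r M) ι)) (pull (liftMap (kingPrV L kk r M) ι))
        (tensorId ι (mulOp (bcube (2 * q) (coverXi M (L ^ r * L ^ kk) w) 2 k) ∘ₗ (mulOp (chiCube M (L ^ r * L ^ kk) (coverCorner M w q m₀ k) (q * w)) ∘ₗ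
          symOp M (L ^ r * L ^ kk) (coverCorner M w q m₀ k) ∘ₗ (gOp M (L ^ r * L ^ kk) a ∘ₗ (mulOp (1 - chiCube M (L ^ r * L ^ kk) (coverCorner M w q m₀ k) (q * w)) ∘ₗ
            (a • (qvAdjRe M (L ^ r * L ^ kk) ∘ₗ qvRe M (L ^ r * L ^ kk)) + (-landauRe M (L ^ r * L ^ kk))) ∘ₗ mulOp (hcube (2 * q) (coverXi M (L ^ r * L ^ kk) w) k))) ∘ₗ
              mulOp (chiCube M (L ^ r * L ^ kk) (coverCorner M w q m₀ k) (q * w)))))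
        (tensorId ι (mulOp (bcube (2 * q) (coverXi M (L ^ kk) w) 2 k) ∘ₗ (mulOp (chiCube M (L ^ kk) (coverCorner M w q m₀ k) (q * w)) ∘ₗ symOp M (L ^ kk) (coverCorner M w q m₀ k) ∘ₗ
          (gOp M (L ^ kk) a ∘ₗ (mulOp (1 - chiCube M (L ^ kk) (coverCorner M w q m₀ k) (q * w)) ∘ₗ (a • (qvAdjRe M (L ^ kk) ∘ₗ qvRe M (L ^ kk)) + (-landauRe M (L ^ kk))) ∘ₗ
            mulOp (hcube (2 * q) (coverXi M (L ^ kk) w) k))) ∘ₗ mulOp (chiCube M (L ^ kk) (coverCorner M w q m₀ k) (q * w))))))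
      (fun y y' => ind (cubeBlocks M (coverCorner M w q m₀ k) (q * w) : Set (Tor M)) y * ind (cubeBlocks M (coverCorner M w q m₀ k) (q * w) : Set (Tor M)) y' *
        ((2 ^ (d + 1) * Real.exp ρ *
            ((1 * C * (((|a| * (Real.exp δN * Real.exp δN) + C₁) * (π * (d + 1) / (((L ^ kk : ℕ) : ℝ) * w)) + rN + 0 * (|a| * (Real.exp δN * Real.exp δN) + C₁)) *
                Real.exp (-((δN - ρ₁) * ((m₀ : ℝ) + 1)))) * cr +
                1 * C₀ * ((|a| * (Real.exp δN * Real.exp δN) + C₁) * Real.exp (-((δN - ρ₁) * ((m₀ : ℝ) + 1)))) * cr) +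
              (d + 1) * (1 * (|(((L ^ kk : ℕ) : ℝ))⁻¹| * CD) * ((|a| * (Real.exp δN * Real.exp δN) + C₁) * Real.exp (-((δN - ρ₁) * ((m₀ : ℝ) + 1)))) * cr)) +
          (π * (d + 1) / (((L ^ kk : ℕ) : ℝ) * w)) * (2 ^ (d + 1) * ((1 : ℝ) * C * ((|a| * (Real.exp δN * Real.exp δN) + C₁) * Real.exp (-((δN - ρ₁) * ((m₀ : ℝ) + 1)))) * cr * Real.exp ρ))) *
        Real.exp (-(ρ * tdistT M y y')))) := by
  have hM' : ∀ ν, M ν = 2 * (q * w) := fun ν => by rw [hM ν, mul_assoc]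
  have hfit' : m₀ + 2 * w ≤ 2 * q * w := by nlinarith
  exact hasMaj_idef_tensorId ι (kingPrV L kk r M) (fun y y' => mul_nonneg (mul_nonneg (ind_nonneg _ _) (ind_nonneg _ _)) (by have := hrow.nonneg y; positivity))
    (hasMaj_idef_adjTail_neumannCubeG_of (L := L) (k := kk) (r := r) (c := coverCorner M w q m₀ k) (S := q * w) hM' htri hrow hC hC₀ hCD hC₁ hδN hδN₁ hrN hρ₁ hρ hρρ₁ hρσ
      (by positivity : (0 : ℝ) ≤ π * (d + 1) / (((L ^ kk : ℕ) : ℝ) * w)) (by positivity : (0 : ℝ) ≤ π * (d + 1) / (((L ^ kk : ℕ) : ℝ) * w)) hG hG' h0 h1 hNL hNL' hDN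
      (H := {y | ∀ ν, m₀ ≤ ((y - coverCorner M w q m₀ k) ν).val ∧ ((y - coverCorner M w q m₀ k) ν).val + 1 ≤ m₀ + 2 * w})
      (fun x => abs_hcube_le_one (2 * q) (coverXi M (L ^ kk) w) k x)
      (fun x hx => by by_contra hne; exact hx fun ν => val_blockOf_sub_of_hcube_ne_zero hM hw hfit' hne ν)
      (fun x' hx' => by by_contra hne; exact hx' fun ν => val_blockOf_sub_of_hcube_ne_zero hM hw hfit' hne ν)
      (fun x' => abs_coverH_fine_sub_le kk r hM hw k x') (fun x' => abs_bcube_cover_le_one 2 k x') (fun x' => abs_bcube_cover_fine_sub_le 2 hM hw k x')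
      (fun y y' hy hy' => margin_le_tdistT hM hfit hy hy'))

end Defect

end Summit.QuantumFields.YangMills.BalabanUVNodes.N15.Gluing

end
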